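/-
Copyright (c) 2026 the pub-hodgecm-mathlib formalisation cell (harness21).  Prover seat hodgecm-mathlib-K2E2-p12 (g4): Track B «K2-LIT», ENGINE E1,
h413 = stmt-HodgeConjecture-24833; FILE 3 of K2E1-plan (g4)'s «R7₂-SCALAR» (2026-09-04T06:53:00Z): the EULER PRODUCT of the `U(J₂)` intertwining scalar at the CM pair.
-/
import Summits.HodgeConjecture.HodgeConjecture.Theorems.K2E1IntertwiningScalarLineIntegralU2    -- ★ (3b): canonically normalised line integral, `h_f^{−σ} ∈ L¹`
import Summits.HodgeConjecture.HodgeConjecture.Theorems.K2E1IntertwiningLocalFactorU2Line      -- ★ (b1)+(b3): `h_f(b)^{−σ} = ∏ᶠ_v P_v(b_v)^{−σ}`, `P_v = max(1,‖·‖_v)²` off `S_δ`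
import Summits.HodgeConjecture.HodgeConjecture.Theorems.K2E1IntertwiningLocalFactorU2          -- ★ FILE 2 (a): `∫ max(1,‖x‖_v)^{−2σ} = μ(𝒪_v)(1−q_v^{−2σ})(1−q_v^{−(2σ−1)})⁻¹`
import Summits.HodgeConjecture.HodgeConjecture.Theorems.K2E1IntertwiningScalarContinuationU2    -- ★ FILE 1: `∏'_{v∉S} (…) = ζ^S(2σ−1)/ζ^S(2σ) ≠ 0`
import Summits.HodgeConjecture.HodgeConjecture.Theorems.AdelicProductIntegralOne                -- ★ (3a): Tate 3.3.1 on `𝔸_{K,f}` (one variable)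
import HarnessLib

/-!
# K2·E1 — `K2E1IntertwiningScalarEulerProductU2` (FILE 3): THE EULER PRODUCT OF THE `U(J₂)` INTERTWINING SCALAR AT THE CM PAIR —
# `c_ν(σ)∕ν(𝓕) = [c_∞(σ)∕μ_E(D_∞)] · (∏_{v ∈ S} a_v(σ)) · ζ^S_{L⁺}(2σ−1)∕ζ^S_{L⁺}(2σ)`, real `σ > 1`

Track B ∕ K2-LIT, crux h413 = `stmt-HodgeConjecture-24833`, route of record `HCCMUnconditional`; cell `hodgecm-mathlib`, squad K2, ENGINE E1 (campaign «EIS-RANK-ONE», R7₂ FILE 3,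
the HEAD of K2E1-plan (g4) 06:53:00Z).  THEOREMS ONLY (no `def`, no instance, no notation, no named-fact hypothesis, no `sorry`; default heartbeats); lane `--supports
stmt-HodgeConjecture-24833 --as helper` (count-neutral).  CM pair `L/L⁺`, `c = complexConj`, `N = 2`, `δ ∈ L⁻ ∖ 0`; `S` any finset of finite places of `L⁺` containing
`S_δ = {v | ∃ w ∣ v, ‖δ‖_w ≠ 1}` (finite, ★ (b3)); `νv` any additive Haar measures on the `L⁺_v`; `ν` ANY Haar measure of `N(𝔸)`, `𝓕` ANY fundamental domain of `N(L⁺)`.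

THE MATHEMATICS [MoeglinWaldspurger1995, II.1.6; Langlands1976, Appendix; GindikinKarpelevich; TateThesis1967, Thm 3.3.1].  With `P_v(x) = ∏_{w∣v} max(1, ‖ι_w x‖_w·‖δ‖_w)` (★ (b3))
and the local factor `f_v(x) = P_v(x)^{−σ}`: §1 off `S` (`‖δ‖_w = 1` for `w ∣ v`) `f_v(x) = max(1,‖x‖_v)^{−2σ}` (★ (b2)∕(b3)) so the LOCAL MEAN `a_v(σ) := νv(𝒪_v)⁻¹·∫ f_v dνv` is
**`(1 − q_v^{−2σ})(1 − q_v^{−(2σ−1)})⁻¹ = ζ_v(2σ−1)∕ζ_v(2σ)`** (★ FILE 2 (a), normalisation-free).  §2 `h_f(b)^{−σ} = ∏ᶠ_v f_v(b_v)` (★ (b1)(b3)) is `μ_f`-integrable for `σ > 1` (★ (3b)),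
so ★ (3a) gives `HasProd a (μ_f(𝒪̂)⁻¹·∫ h_f^{−σ} dμ_f)` over ALL `v`.  §3 splitting off `S` (Mathlib `HasProd.mul_compl`, `Finset.hasProd`) and ★ FILE 1 `hasProd_localScalar`:
**`μ_f(𝒪̂)⁻¹·∫_{𝔸_{L⁺,f}} h_f^{−σ} dμ_f = (∏_{v∈S} a_v(σ)) · ζ^S_{L⁺}(2σ−1)∕ζ^S_{L⁺}(2σ)`**.  §4 with ★ (3b)'s canonically normalised line integral: for every Haar `ν` of `N(𝔸)` and every
fundamental domain `𝓕` of `N(L⁺)`,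
**`ν(𝓕)⁻¹ · ∫_{N(𝔸)} H(w₀ v)^σ dν = [μ_E(D_∞)⁻¹·∫_{L⁺⊗ℝ} A(s)^{−σ} dμ_E] · (∏_{v∈S} a_v(σ)) · ζ^S_{L⁺}(2σ−1)∕ζ^S_{L⁺}(2σ)`** — the R7₂ scalar at `N = 2`: by ★ FILE 1 the right-hand
`ζ`-ratio has exactly one pole on `Re σ > ½` (simple, at `σ = 1`); the archimedean factor `c_∞(σ)∕μ_E(D_∞)` is left as the integral (its Γ-form is K2E3-p12's `K2E1ArchWhittakerConstantTerm`).
HONEST LABEL: HC_CM is proved only modulo the 7 printed citations (2 remaining named inputs: hLiu418 = `stmt-HodgeConjecture-24832`, h413 = `stmt-HodgeConjecture-24833`) until rung 0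
closes; this file asserts no named fact and closes no socket; count-neutral.

## References
* [MoeglinWaldspurger1995] C. Mœglin, J.-L. Waldspurger, *Spectral Decomposition and Eisenstein Series* (1995), II.1.6.
* [Langlands1976] R. P. Langlands, *On the Functional Equations Satisfied by Eisenstein Series*, LNM 544 (1976), Appendix.
* [GindikinKarpelevich] S. G. Gindikin, F. I. Karpelevič, Dokl. Akad. Nauk SSSR 145 (1962), 252–255.
* [TateThesis1967] J. Tate, in Cassels–Fröhlich (1967), Thm 3.3.1.
-/

set_option autoImplicit false
set_option linter.dupNamespace false -- the mandated namespace repeats `HodgeConjecture.HodgeConjecture`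

noncomputable section

open MeasureTheory Measure NumberField NumberField.InfinitePlace NumberField.mixedEmbedding IsDedekindDomain IsDedekindDomain.HeightOneSpectrum Set Filter Function
open scoped ENNReal NNReal Classical
open Literature.NumberTheory.GaloisRepresentations.IsNonarchimedeanLocalField
open Literature.NumberTheory.Automorphic Literature.NumberTheory.Automorphic.UnitaryGroup AdelicGroupData Literature.NumberTheory.LFunctions
open Summit.HodgeConjecture.HodgeConjecture.Cruxes.H413
open Summit.HodgeConjecture.HodgeConjecture.Cruxes.H413.K2E1IntertwiningLocalFactorU2Line
open Summit.HodgeConjecture.HodgeConjecture.Cruxes.H413.K2E1IntertwiningLocalFactorU2 (integral_max_one_normAbs_cpow_two_mul_adicCompletion)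
open Summit.HodgeConjecture.HodgeConjecture.Cruxes.H413.K2E1IntertwiningScalarContinuationU2 (hasProd_localScalar)
open Summit.HodgeConjecture.HodgeConjecture.Cruxes.H413.AdelicProductIntegralOne (hasProd_localIntegral_of_integrable_one)
open Summit.HodgeConjecture.HodgeConjecture.Cruxes.H413.K2E1IntertwiningScalarLineIntegralU2

namespace Summit.HodgeConjecture.HodgeConjecture.Cruxes.H413.K2E1IntertwiningScalarEulerProductU2

variable (L : Type) [Field L] [NumberField L] [IsCMField L]
  (hij : (((0 : Fin 2) : ℕ)) + 1 = ((1 : Fin 2) : ℕ)) (hN : 2 = 2 * ((0 : Fin 2) : ℕ) + 2)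
  {δ : L} (hcδ : IsCMField.complexConj L δ = -δ) (hδ : δ ≠ 0)
  [∀ v : HeightOneSpectrum (𝓞 ↥(maximalRealSubfield L)), MeasurableSpace (v.adicCompletion ↥(maximalRealSubfield L))]
  [∀ v : HeightOneSpectrum (𝓞 ↥(maximalRealSubfield L)), BorelSpace (v.adicCompletion ↥(maximalRealSubfield L))]
  (νv : ∀ v : HeightOneSpectrum (𝓞 ↥(maximalRealSubfield L)), Measure (v.adicCompletion ↥(maximalRealSubfield L))) [∀ v, (νv v).IsAddHaarMeasure]
  {σ : ℝ}

/-! ## §1 The local factor `f_v = P_v^{−σ}` and its mean `a_v(σ)`: off `S`, `a_v(σ) = (1 − q_v^{−2σ})(1 − q_v^{−(2σ−1)})⁻¹` -/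

omit [IsCMField L] [∀ v : HeightOneSpectrum (𝓞 ↥(maximalRealSubfield L)), MeasurableSpace (v.adicCompletion ↥(maximalRealSubfield L))]
  [∀ v : HeightOneSpectrum (𝓞 ↥(maximalRealSubfield L)), BorelSpace (v.adicCompletion ↥(maximalRealSubfield L))] [∀ v, (νv v).IsAddHaarMeasure] in
/-- `1 ≤ P_v(x)` (every factor is a `max(1, ·)`). [folklore] -/
theorem one_le_localHeight (v : HeightOneSpectrum (𝓞 ↥(maximalRealSubfield L))) (x : v.adicCompletion ↥(maximalRealSubfield L)) : (1 : ℝ≥0) ≤ (letI := Extension.fintype (𝓞 ↥(maximalRealSubfield L)) ↥(maximalRealSubfield L) L (𝓞 L) v; ∏ w : v.Extension (𝓞 L), max 1 (normAbs (w.1.adicCompletion L) (Extension.adicCompletionSemialgHom ↥(maximalRealSubfield L) L w x) * normAbs (w.1.adicCompletion L) ((algebraMap L (FiniteAdeleRing (𝓞 L) L) δ) w.1))) := by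
  letI := Extension.fintype (𝓞 ↥(maximalRealSubfield L)) ↥(maximalRealSubfield L) L (𝓞 L) v
  exact Finset.one_le_prod' fun w _ => le_max_left _ _

omit [IsCMField L] [∀ v : HeightOneSpectrum (𝓞 ↥(maximalRealSubfield L)), MeasurableSpace (v.adicCompletion ↥(maximalRealSubfield L))]
  [∀ v : HeightOneSpectrum (𝓞 ↥(maximalRealSubfield L)), BorelSpace (v.adicCompletion ↥(maximalRealSubfield L))] [∀ v, (νv v).IsAddHaarMeasure] in
/-- **`f_v` is continuous** (★ (b3) `continuous_prod_extension_max_one`, `P_v ≥ 1`, real power, `ofReal`). [folklore] -/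
theorem continuous_localFactor (σ : ℝ) (v : HeightOneSpectrum (𝓞 ↥(maximalRealSubfield L))) :
    Continuous fun x : v.adicCompletion ↥(maximalRealSubfield L) => ((((((letI := Extension.fintype (𝓞 ↥(maximalRealSubfield L)) ↥(maximalRealSubfield L) L (𝓞 L) v; ∏ w : v.Extension (𝓞 L), max 1 (normAbs (w.1.adicCompletion L) (Extension.adicCompletionSemialgHom ↥(maximalRealSubfield L) L w x) * normAbs (w.1.adicCompletion L) ((algebraMap L (FiniteAdeleRing (𝓞 L) L) δ) w.1))) : ℝ≥0) : ℝ) ^ (-σ) : ℝ)) : ℂ) := by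
  refine Complex.continuous_ofReal.comp ?_
  refine (NNReal.continuous_coe.comp (continuous_prod_extension_max_one (E := L) (δ := δ) v)).rpow_const fun x => Or.inl ?_
  exact ne_of_gt (lt_of_lt_of_le zero_lt_one (by exact_mod_cast one_le_localHeight L v x))

omit [∀ v : HeightOneSpectrum (𝓞 ↥(maximalRealSubfield L)), MeasurableSpace (v.adicCompletion ↥(maximalRealSubfield L))]
  [∀ v : HeightOneSpectrum (𝓞 ↥(maximalRealSubfield L)), BorelSpace (v.adicCompletion ↥(maximalRealSubfield L))] [∀ v, (νv v).IsAddHaarMeasure] in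
/-- **Off `S_δ` the local factor is `max(1, ‖x‖_v)^{−2σ}`** in FILE 2 (a)'s complex spelling (★ (b3) `prod_extension_max_one_eq_sq`; positive real base, so `ofReal_cpow`).
[cite: MoeglinWaldspurger1995, II.1.6] -/
theorem localFactor_eq_of_unit (σ : ℝ) (v : HeightOneSpectrum (𝓞 ↥(maximalRealSubfield L)))
    (hv : ∀ w : v.Extension (𝓞 L), normAbs (w.1.adicCompletion L) ((algebraMap L (FiniteAdeleRing (𝓞 L) L) δ) w.1) = 1) (x : v.adicCompletion ↥(maximalRealSubfield L)) :
    ((((((letI := Extension.fintype (𝓞 ↥(maximalRealSubfield L)) ↥(maximalRealSubfield L) L (𝓞 L) v; ∏ w : v.Extension (𝓞 L), max 1 (normAbs (w.1.adicCompletion L) (Extension.adicCompletionSemialgHom ↥(maximalRealSubfield L) L w x) * normAbs (w.1.adicCompletion L) ((algebraMap L (FiniteAdeleRing (𝓞 L) L) δ) w.1))) : ℝ≥0) : ℝ) ^ (-σ) : ℝ)) : ℂ) = ((max 1 ((normAbs (v.adicCompletion ↥(maximalRealSubfield L)) x : ℝ≥0) : ℝ) : ℝ) : ℂ) ^ (-(2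 * (σ : ℂ))) := by
  have h2 := prod_extension_max_one_eq_sq (E := L) v hv x
  rw [h2, NNReal.coe_pow, NNReal.coe_max, NNReal.coe_one]
  have hm : (0 : ℝ) ≤ max 1 ((normAbs (v.adicCompletion ↥(maximalRealSubfield L)) x : ℝ≥0) : ℝ) := by positivity
  rw [show (-σ : ℝ) = ((2 : ℕ) : ℝ)⁻¹ * (-(2 * σ)) by push_cast; ring, Real.rpow_mul (pow_nonneg hm 2), Real.pow_rpow_inv_natCast hm two_ne_zero,
    Complex.ofReal_cpow hm]
  push_cast
  ring_nf

omit [IsCMField L] [∀ v : HeightOneSpectrum (𝓞 ↥(maximalRealSubfield L)), MeasurableSpace (v.adicCompletion ↥(maximalRealSubfield L))]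
  [∀ v : HeightOneSpectrum (𝓞 ↥(maximalRealSubfield L)), BorelSpace (v.adicCompletion ↥(maximalRealSubfield L))] [∀ v, (νv v).IsAddHaarMeasure] in
/-- **Off `S_δ` the local factor is `1` on `𝒪_v`** (★ (b3) `prod_extension_max_one_eq_one_of_mem_integers`). [cite: TateThesis1967, Thm 3.3.1] -/
theorem localFactor_eq_one_of_mem_integers (σ : ℝ) (v : HeightOneSpectrum (𝓞 ↥(maximalRealSubfield L)))
    (hv : ∀ w : v.Extension (𝓞 L), normAbs (w.1.adicCompletion L) ((algebraMap L (FiniteAdeleRing (𝓞 L) L) δ) w.1) = 1)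
    {x : v.adicCompletion ↥(maximalRealSubfield L)} (hx : x ∈ v.adicCompletionIntegers ↥(maximalRealSubfield L)) : ((((((letI := Extension.fintype (𝓞 ↥(maximalRealSubfield L)) ↥(maximalRealSubfield L) L (𝓞 L) v; ∏ w : v.Extension (𝓞 L), max 1 (normAbs (w.1.adicCompletion L) (Extension.adicCompletionSemialgHom ↥(maximalRealSubfield L) L w x) * normAbs (w.1.adicCompletion L) ((algebraMap L (FiniteAdeleRing (𝓞 L) L) δ) w.1))) : ℝ≥0) : ℝ) ^ (-σ) : ℝ)) : ℂ) = 1 := by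
  have h1 := prod_extension_max_one_eq_one_of_mem_integers (E := L) v hv hx
  rw [h1, NNReal.coe_one, Real.one_rpow, Complex.ofReal_one]

/-- **THE LOCAL MEAN OFF `S_δ` IS FILE 1's EULER FACTOR**: `νv(𝒪_v)⁻¹·∫_{L⁺_v} f_v dνv = (1 − q_v^{−2σ})·(1 − q_v^{−(2σ−1)})⁻¹` for real `σ > ½` — normalisation-free (★ FILE 2 (a)
`integral_max_one_normAbs_cpow_two_mul_adicCompletion`, `𝒪_v = 𝔭_v^0` ★ `mem_primePowBall_zero_iff`). [cite: Langlands1976, Appendix] [cite: MoeglinWaldspurger1995, II.1.6] -/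
theorem localMean_eq_eulerFactor (hσ : 1 / 2 < σ) (v : HeightOneSpectrum (𝓞 ↥(maximalRealSubfield L)))
    (hv : ∀ w : v.Extension (𝓞 L), normAbs (w.1.adicCompletion L) ((algebraMap L (FiniteAdeleRing (𝓞 L) L) δ) w.1) = 1) :
    ((νv v (v.adicCompletionIntegers ↥(maximalRealSubfield L))).toReal⁻¹ • ∫ x, ((((((letI := Extension.fintype (𝓞 ↥(maximalRealSubfield L)) ↥(maximalRealSubfield L) L (𝓞 L) v; ∏ w : v.Extension (𝓞 L), max 1 (normAbs (w.1.adicCompletion L) (Extension.adicCompletionSemialgHom ↥(maximalRealSubfield L) L w x) * normAbs (w.1.adicCompletion L) ((algebraMap L (FiniteAdeleRing (𝓞 L) L) δ) w.1))) : ℝ≥0) : ℝ) ^ (-σ) : ℝ)) : ℂ) ∂νv v) = ((1 - (v.residueCard : ℂ) ^ (-(2 * (σ : ℂ)))) * (1 - (v.residueCard : ℂ) ^ (-(2 * (σ : ℂ) - 1)))⁻¹) := by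
  have hσ' : 1 / 2 < ((σ : ℂ)).re := by rwa [Complex.ofReal_re]
  simp_rw [localFactor_eq_of_unit L σ v hv]
  rw [integral_max_one_normAbs_cpow_two_mul_adicCompletion v (νv v) hσ']
  have hball : primePowBall (v.adicCompletion ↥(maximalRealSubfield L)) 0 = (v.adicCompletionIntegers ↥(maximalRealSubfield L) : Set (v.adicCompletion ↥(maximalRealSubfield L))) :=
    Set.ext fun x => mem_primePowBall_zero_iff x
  have hpos : 0 < (νv v).real (primePowBall (v.adicCompletion ↥(maximalRealSubfield L)) 0) := LocalFieldHaar.measureReal_primePowBall_pos (νv v) 0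
  rw [Complex.real_smul, ← mul_assoc, ← Complex.ofReal_mul, show (νv v (v.adicCompletionIntegers ↥(maximalRealSubfield L))).toReal =
      (νv v).real (primePowBall (v.adicCompletion ↥(maximalRealSubfield L)) 0) by rw [Measure.real, hball], inv_mul_cancel₀ hpos.ne',
    Complex.ofReal_one, one_mul]

/-! ## §2 `HasProd a (μ_f(𝒪̂)⁻¹·∫ h_f^{−σ} dμ_f)` over all finite places of `L⁺` (★ (3a) + ★ (b1)(b3) + ★ (3b)) -/

section Finite

variable [MeasurableSpace (FiniteAdeleRing (𝓞 ↥(maximalRealSubfield L)) ↥(maximalRealSubfield L))] [BorelSpace (FiniteAdeleRing (𝓞 ↥(maximalRealSubfield L)) ↥(maximalRealSubfield L))]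

omit [∀ v : HeightOneSpectrum (𝓞 ↥(maximalRealSubfield L)), MeasurableSpace (v.adicCompletion ↥(maximalRealSubfield L))]
  [∀ v : HeightOneSpectrum (𝓞 ↥(maximalRealSubfield L)), BorelSpace (v.adicCompletion ↥(maximalRealSubfield L))] [∀ v, (νv v).IsAddHaarMeasure]
  [MeasurableSpace (FiniteAdeleRing (𝓞 ↥(maximalRealSubfield L)) ↥(maximalRealSubfield L))] [BorelSpace (FiniteAdeleRing (𝓞 ↥(maximalRealSubfield L)) ↥(maximalRealSubfield L))] in
/-- **`∏ᶠ_v f_v(b_v) = h_f(b)^{−σ}`** in `ℂ` (★ (b1)(b3) `coe_finprod_max_one_nnnorm_traceZeroLine_snd_rpow`, `ofReal` through the finite product). [cite: TateThesis1967, Thm 3.3.1] -/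
theorem finprod_localFactor_eq (σ : ℝ) (b : FiniteAdeleRing (𝓞 ↥(maximalRealSubfield L)) ↥(maximalRealSubfield L)) :
    (∏ᶠ v : HeightOneSpectrum (𝓞 ↥(maximalRealSubfield L)), ((((((letI := Extension.fintype (𝓞 ↥(maximalRealSubfield L)) ↥(maximalRealSubfield L) L (𝓞 L) v; ∏ w : v.Extension (𝓞 L), max 1 (normAbs (w.1.adicCompletion L) (Extension.adicCompletionSemialgHom ↥(maximalRealSubfield L) L w (b v)) * normAbs (w.1.adicCompletion L) ((algebraMap L (FiniteAdeleRing (𝓞 L) L) δ) w.1))) : ℝ≥0) : ℝ) ^ (-σ) : ℝ)) : ℂ)) = ((((∏ᶠ v : HeightOneSpectrum (𝓞 L), max 1 ‖((traceZeroLine ↥(maximalRealSubfield L) L (IsCMField.complexConj L) hcδ hδ ((0, b) : AdeleRing (𝓞 ↥(maximalRealSubfield L)) ↥(maximalRealSubfield L)) : traceZeroAdele ↥(maximalRealSubfield L) L (IsCMField.complexConj L)) : AdeleRing (𝓞 L) L).2 v‖₊ : ℝ≥0) : ℝ) ^ (-σ) : ℝ) : ℂ) := by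
  rw [coe_finprod_max_one_nnnorm_traceZeroLine_snd_rpow (IsCMField.complexConj L) hcδ hδ 0 b σ]
  exact (Complex.ofRealHom.toMonoidHom.map_finprod_of_injective Complex.ofReal_injective _).symm

include hij hN in
/-- **THE EULER PRODUCT OVER ALL `v`**: for real `σ > 1`, every additive Haar `μ_f` on `𝔸_{L⁺,f}` and Haar family `νv`, and every finset `S ⊇ S_δ`,
`HasProd (v ↦ a_v(σ)) (μ_f(𝒪̂)⁻¹ · ∫ h_f(b)^{−σ} dμ_f(b))` (★ (3a) Tate 3.3.1; continuity §1; `f_v = 1` on `𝒪_v` off `S`; integrability ★ (3b)). [cite: TateThesis1967, Thm 3.3.1] [cite: MoeglinWaldspurger1995, II.1.6] -/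
theorem hasProd_localMean (hσ : 1 < σ) (μf : Measure (FiniteAdeleRing (𝓞 ↥(maximalRealSubfield L)) ↥(maximalRealSubfield L))) [μf.IsAddHaarMeasure]
    (S : Finset (HeightOneSpectrum (𝓞 ↥(maximalRealSubfield L)))) (hS : ∀ v ∉ S, ∀ w : v.Extension (𝓞 L), normAbs (w.1.adicCompletion L) ((algebraMap L (FiniteAdeleRing (𝓞 L) L) δ) w.1) = 1) :
    HasProd (fun v : HeightOneSpectrum (𝓞 ↥(maximalRealSubfield L)) => ((νv v (v.adicCompletionIntegers ↥(maximalRealSubfield L))).toReal⁻¹ • ∫ x, ((((((letI := Extension.fintype (𝓞 ↥(maximalRealSubfield L)) ↥(maximalRealSubfield L) L (𝓞 L) v; ∏ w : v.Extension (𝓞 L), max 1 (normAbs (w.1.adicCompletion L) (Extension.adicCompletionSemialgHom ↥(maximalRealSubfield L) L w x) * normAbs (w.1.adicCompletion L) ((algebraMap L (FiniteAdeleRing (𝓞 L) L) δ) w.1))) : ℝ≥0) : ℝ) ^ (-σ) : ℝ)) : ℂ) ∂νv v))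
      ((μf {b : FiniteAdeleRing (𝓞 ↥(maximalRealSubfield L)) ↥(maximalRealSubfield L) | ∀ v, b v ∈ v.adicCompletionIntegers ↥(maximalRealSubfield L)}).toReal⁻¹ • (((∫ b, ((∏ᶠ v : HeightOneSpectrum (𝓞 L), max 1 ‖((traceZeroLine ↥(maximalRealSubfield L) L (IsCMField.complexConj L) hcδ hδ ((0, b) : AdeleRing (𝓞 ↥(maximalRealSubfield L)) ↥(maximalRealSubfield L)) : traceZeroAdele ↥(maximalRealSubfield L) L (IsCMField.complexConj L)) : AdeleRing (𝓞 L) L).2 v‖₊ : ℝ≥0) : ℝ) ^ (-σ) ∂μf : ℝ)) : ℂ)) := by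
  letI : MeasurableSpace (quasiSplit (↥(maximalRealSubfield L)) L (IsCMField.complexConj L) 2).Adelic := borel _
  haveI : BorelSpace (quasiSplit (↥(maximalRealSubfield L)) L (IsCMField.complexConj L) 2).Adelic := ⟨rfl⟩
  have h := hasProd_localIntegral_of_integrable_one ↥(maximalRealSubfield L) μf νv
    (fun v x => ((((((letI := Extension.fintype (𝓞 ↥(maximalRealSubfield L)) ↥(maximalRealSubfield L) L (𝓞 L) v; ∏ w : v.Extension (𝓞 L), max 1 (normAbs (w.1.adicCompletion L) (Extension.adicCompletionSemialgHom ↥(maximalRealSubfield L) L w x) * normAbs (w.1.adicCompletion L) ((algebraMap L (FiniteAdeleRing (𝓞 L) L) δ) w.1))) : ℝ≥0) : ℝ) ^ (-σ) : ℝ)) : ℂ)) S (fun v => continuous_localFactor L σ v) (fun v hv z hz => localFactor_eq_one_of_mem_integers L σ v (hS v hv) hz)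
    (by
      simp_rw [finprod_localFactor_eq L hcδ hδ σ]
      exact (integrable_finFactor_rpow_neg_cm_two L hij hN hcδ hδ μf hσ).ofReal)
  simp_rw [finprod_localFactor_eq L hcδ hδ σ] at h
  rwa [integral_complex_ofReal] at h

/-! ## §3 Splitting off `S`: `μ_f(𝒪̂)⁻¹·∫ h_f^{−σ} dμ_f = (∏_{v∈S} a_v(σ)) · ζ^S(2σ−1)∕ζ^S(2σ)` -/

include hij hN in
/-- **THE FINITE PART OF THE INTERTWINING SCALAR IS AN EULER PRODUCT**: for real `σ > 1`,
`μ_f(𝒪̂)⁻¹·∫_{𝔸_{L⁺,f}} h_f(b)^{−σ} dμ_f(b) = (∏_{v ∈ S} a_v(σ)) · ζ^S_{L⁺}(2σ−1)∕ζ^S_{L⁺}(2σ)` (`ζ^S = partialStandardL S 1`; §2, §1 off `S`, ★ FILE 1 `hasProd_localScalar`, Mathlib `HasProd.mul_compl`,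
`HasProd.unique`). [cite: MoeglinWaldspurger1995, II.1.6] [cite: Langlands1976, Appendix] -/
theorem inv_measure_mul_integral_finFactor_eq_eulerProduct (hσ : 1 < σ) (μf : Measure (FiniteAdeleRing (𝓞 ↥(maximalRealSubfield L)) ↥(maximalRealSubfield L))) [μf.IsAddHaarMeasure]
    (S : Finset (HeightOneSpectrum (𝓞 ↥(maximalRealSubfield L)))) (hS : ∀ v ∉ S, ∀ w : v.Extension (𝓞 L), normAbs (w.1.adicCompletion L) ((algebraMap L (FiniteAdeleRing (𝓞 L) L) δ) w.1) = 1) :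
    (μf {b : FiniteAdeleRing (𝓞 ↥(maximalRealSubfield L)) ↥(maximalRealSubfield L) | ∀ v, b v ∈ v.adicCompletionIntegers ↥(maximalRealSubfield L)}).toReal⁻¹ • (((∫ b, ((∏ᶠ v : HeightOneSpectrum (𝓞 L), max 1 ‖((traceZeroLine ↥(maximalRealSubfield L) L (IsCMField.complexConj L) hcδ hδ ((0, b) : AdeleRing (𝓞 ↥(maximalRealSubfield L)) ↥(maximalRealSubfield L)) : traceZeroAdele ↥(maximalRealSubfield L) L (IsCMField.complexConj L)) : AdeleRing (𝓞 L) L).2 v‖₊ : ℝ≥0) : ℝ) ^ (-σ) ∂μf : ℝ)) : ℂ) = (∏ v ∈ S, ((νv v (v.adicCompletionIntegers ↥(maximalRealSubfield L))).toReal⁻¹ • ∫ x, ((((((letI := Extension.fintype (𝓞 ↥(maximalRealSubfield L)) ↥(maximalRealSubfield L) L (𝓞 L) v; ∏ w : v.Extension (𝓞 L), max 1 (normAbs (w.1.adicCompletion L) (Extension.adicCompletionSemialgHom ↥(maximalRealSubfield L) L w x) * normAbs (w.1.adicCompletion L) ((algebraMap L (FiniteAdeleRing (𝓞 L) L) δ)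 w.1))) : ℝ≥0) : ℝ) ^ (-σ) : ℝ)) : ℂ) ∂νv v)) * (partialStandardL (↑S : Set (HeightOneSpectrum (𝓞 ↥(maximalRealSubfield L)))) (fun _ => {1}) (2 * (σ : ℂ) - 1) / partialStandardL (↑S : Set (HeightOneSpectrum (𝓞 ↥(maximalRealSubfield L)))) (fun _ => {1}) (2 * (σ : ℂ))) := by
  have hσ' : 1 < ((σ : ℂ)).re := by rwa [Complex.ofReal_re]
  have hall := hasProd_localMean L hij hN hcδ hδ νv hσ μf S hS
  -- on `S`: the finite product; off `S`: ★ FILE 1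
  have hS' : HasProd ((fun v : HeightOneSpectrum (𝓞 ↥(maximalRealSubfield L)) => ((νv v (v.adicCompletionIntegers ↥(maximalRealSubfield L))).toReal⁻¹ • ∫ x, ((((((letI := Extension.fintype (𝓞 ↥(maximalRealSubfield L)) ↥(maximalRealSubfield L) L (𝓞 L) v; ∏ w : v.Extension (𝓞 L), max 1 (normAbs (w.1.adicCompletion L) (Extension.adicCompletionSemialgHom ↥(maximalRealSubfield L) L w x) * normAbs (w.1.adicCompletion L) ((algebraMap L (FiniteAdeleRing (𝓞 L) L) δ) w.1))) : ℝ≥0) : ℝ) ^ (-σ) : ℝ)) : ℂ) ∂νv v)) ∘ (↑) : (↑S : Set (HeightOneSpectrum (𝓞 ↥(maximalRealSubfield L)))) → ℂ)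
      (∏ v ∈ S, ((νv v (v.adicCompletionIntegers ↥(maximalRealSubfield L))).toReal⁻¹ • ∫ x, ((((((letI := Extension.fintype (𝓞 ↥(maximalRealSubfield L)) ↥(maximalRealSubfield L) L (𝓞 L) v; ∏ w : v.Extension (𝓞 L), max 1 (normAbs (w.1.adicCompletion L) (Extension.adicCompletionSemialgHom ↥(maximalRealSubfield L) L w x) * normAbs (w.1.adicCompletion L) ((algebraMap L (FiniteAdeleRing (𝓞 L) L) δ) w.1))) : ℝ≥0) : ℝ) ^ (-σ) : ℝ)) : ℂ) ∂νv v)) := S.hasProd _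
  have hoff := (hasProd_localScalar (F := ↥(maximalRealSubfield L)) (S := (↑S : Set (HeightOneSpectrum (𝓞 ↥(maximalRealSubfield L))))) hσ').1
  have hfun : ((fun v : HeightOneSpectrum (𝓞 ↥(maximalRealSubfield L)) => ((νv v (v.adicCompletionIntegers ↥(maximalRealSubfield L))).toReal⁻¹ • ∫ x, ((((((letI := Extension.fintype (𝓞 ↥(maximalRealSubfield L)) ↥(maximalRealSubfield L) L (𝓞 L) v; ∏ w : v.Extension (𝓞 L), max 1 (normAbs (w.1.adicCompletion L) (Extension.adicCompletionSemialgHom ↥(maximalRealSubfield L) L w x) * normAbs (w.1.adicCompletion L) ((algebraMap L (FiniteAdeleRing (𝓞 L) L) δ) w.1))) : ℝ≥0) : ℝ) ^ (-σ) : ℝ)) : ℂ) ∂νv v)) ∘ (↑) : ↥((↑S : Set (HeightOneSpectrum (𝓞 ↥(maximalRealSubfield L))))ᶜ) → ℂ) =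
      fun v : {v : HeightOneSpectrum (𝓞 ↥(maximalRealSubfield L)) // v ∉ (↑S : Set (HeightOneSpectrum (𝓞 ↥(maximalRealSubfield L))))} => ((1 - (v.1.residueCard : ℂ) ^ (-(2 * (σ : ℂ)))) * (1 - (v.1.residueCard : ℂ) ^ (-(2 * (σ : ℂ) - 1)))⁻¹) := by
    funext v
    exact localMean_eq_eulerFactor L νv (by linarith) v.1 (hS v.1 fun h => v.2 (Finset.mem_coe.2 h))
  have hoff' : HasProd ((fun v : HeightOneSpectrum (𝓞 ↥(maximalRealSubfield L)) => ((νv v (v.adicCompletionIntegers ↥(maximalRealSubfield L))).toReal⁻¹ • ∫ x, ((((((letI := Extension.fintype (𝓞 ↥(maximalRealSubfield L)) ↥(maximalRealSubfield L) L (𝓞 L) v; ∏ w : v.Extension (𝓞 L), max 1 (normAbs (w.1.adicCompletion L) (Extension.adicCompletionSemialgHom ↥(maximalRealSubfield L) L w x) * normAbs (w.1.adicCompletion L) ((algebraMap L (FiniteAdeleRing (𝓞 L) L) δ) w.1))) : ℝ≥0) : ℝ) ^ (-σ) : ℝ)) : ℂ) ∂νv v)) ∘ (↑) : ↥((↑S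 : Set (HeightOneSpectrum (𝓞 ↥(maximalRealSubfield L))))ᶜ) → ℂ) (partialStandardL (↑S : Set (HeightOneSpectrum (𝓞 ↥(maximalRealSubfield L)))) (fun _ => {1}) (2 * (σ : ℂ) - 1) / partialStandardL (↑S : Set (HeightOneSpectrum (𝓞 ↥(maximalRealSubfield L)))) (fun _ => {1}) (2 * (σ : ℂ))) := by
    rw [hfun]; exact hoff
  exact hall.unique (hS'.mul_compl hoff')

end Finite

/-! ## §4 THE R7₂ SCALAR AT `N = 2`: `ν(𝓕)⁻¹·c_ν(σ) = [μ_E(D_∞)⁻¹·c_∞(σ)] · (∏_{v∈S} a_v(σ)) · ζ^S(2σ−1)∕ζ^S(2σ)` -/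

section Assembly

variable [MeasurableSpace (quasiSplit (↥(maximalRealSubfield L)) L (IsCMField.complexConj L) 2).Adelic] [BorelSpace (quasiSplit (↥(maximalRealSubfield L)) L (IsCMField.complexConj L) 2).Adelic]
  [MeasurableSpace (FiniteAdeleRing (𝓞 ↥(maximalRealSubfield L)) ↥(maximalRealSubfield L))] [BorelSpace (FiniteAdeleRing (𝓞 ↥(maximalRealSubfield L)) ↥(maximalRealSubfield L))]

include hij hN hcδ hδ in
/-- **THE EULER PRODUCT OF THE `U(J₂)` INTERTWINING SCALAR (R7₂, `N = 2`, CM pair).**  For real `σ > 1`, EVERY Haar measure `ν` of `N(𝔸)`, EVERY fundamental domain `𝓕` of `N(L⁺)`,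
every additive Haar `μ_E` on `L⁺ ⊗ ℝ`, `μ_f` on `𝔸_{L⁺,f}`, `νv` on the `L⁺_v`, and every finset `S ⊇ S_δ`:
`ν(𝓕)⁻¹ · ∫_{N(𝔸)} H(w₀ v)^σ dν(v) = [μ_E(D_∞)⁻¹ · ∫_{L⁺⊗ℝ} A(s)^{−σ} dμ_E(s)] · (∏_{v ∈ S} a_v(σ)) · ζ^S_{L⁺}(2σ−1)∕ζ^S_{L⁺}(2σ)`
(`A(s) = ∏_{w∣∞}(1 + (wδ)²s_{w|L⁺}²)`, `a_v(σ) = νv(𝒪_v)⁻¹·∫ P_v^{−σ} dνv`, `ζ^S = partialStandardL S 1`): ★ (3b) `inv_measure_mul_integral_borelHeight_rpow_eq_cm_two` × §3.  By ★ FILE 1 the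
`ζ`-ratio extends to `{Re σ > ½}` with exactly one pole, simple, at `σ = 1` — the R7₂ row of the spectral ceiling at `N = 2`. [cite: MoeglinWaldspurger1995, II.1.6] [cite: Langlands1976, Appendix] -/
theorem inv_measure_mul_intertwiningScalar_eq_eulerProduct (hσ : 1 < σ) (ν : Measure ↥(adelicUnipotent (↥(maximalRealSubfield L)) L (IsCMField.complexConj L) 2)) [ν.IsHaarMeasure]
    {𝓕 : Set ↥(adelicUnipotent (↥(maximalRealSubfield L)) L (IsCMField.complexConj L) 2)} (h𝓕 : IsFundamentalDomain ↥(rationalUnipotent (↥(maximalRealSubfield L)) L (IsCMField.complexConj L) 2) 𝓕 ν)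
    (μE : Measure (mixedSpace ↥(maximalRealSubfield L))) [μE.IsAddHaarMeasure] (μf : Measure (FiniteAdeleRing (𝓞 ↥(maximalRealSubfield L)) ↥(maximalRealSubfield L))) [μf.IsAddHaarMeasure]
    (S : Finset (HeightOneSpectrum (𝓞 ↥(maximalRealSubfield L)))) (hS : ∀ v ∉ S, ∀ w : v.Extension (𝓞 L), normAbs (w.1.adicCompletion L) ((algebraMap L (FiniteAdeleRing (𝓞 L) L) δ) w.1) = 1) :
    ((((ν 𝓕).toReal⁻¹ * ∫ v, (borelHeight (((quasiSplit (↥(maximalRealSubfield L)) L (IsCMField.complexConj L) 2).toAdelic (weylLongU ((IsCMField.complexConj L : L ≃ₐ[↥(maximalRealSubfield L)] L) : L →+* L) (rfl : ((StdForm.antidiagonal 2).over L) = ((StdForm.antidiagonal 2).over L)))) * (v : (quasiSplit (↥(maximalRealSubfield L)) L (IsCMField.complexConj L) 2).Adelic)) : ℝ) ^ σ ∂ν : ℝ)) : ℂ) =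
      ((((μE (ZSpan.fundamentalDomain (latticeBasis ↥(maximalRealSubfield L)))).toReal⁻¹ * ∫ s, (∏ w : InfinitePlace L, ((1 : ℝ) + (w δ) ^ 2 * (s.1 ⟨w.comap (algebraMap ↥(maximalRealSubfield L) L), K2E1HeightBigCellLineFormulaU2.isReal_comap_maximalRealSubfield L w⟩) ^ 2)) ^ (-σ) ∂μE : ℝ)) : ℂ) * ((∏ v ∈ S, ((νv v (v.adicCompletionIntegers ↥(maximalRealSubfield L))).toReal⁻¹ • ∫ x, ((((((letI := Extension.fintype (𝓞 ↥(maximalRealSubfield L)) ↥(maximalRealSubfield L) L (𝓞 L) v; ∏ w : v.Extension (𝓞 L), max 1 (normAbs (w.1.adicCompletion L) (Extension.adicCompletionSemialgHom ↥(maximalRealSubfield L) L w x) * normAbs (w.1.adicCompletion L) ((algebraMap L (FiniteAdeleRing (𝓞 L) L) δ) w.1))) : ℝ≥0) : ℝ) ^ (-σ) : ℝ)) : ℂ) ∂νv v)) * (partialStandardL (↑S : Set (HeightOneSpectrum (𝓞 ↥(maximalRealSubfield L)))) (fun _ => {1}) (2 * (σ : ℂ) - 1) / partialStandardL (↑S :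 Set (HeightOneSpectrum (𝓞 ↥(maximalRealSubfield L)))) (fun _ => {1}) (2 * (σ : ℂ)))) := by
  rw [inv_measure_mul_integral_borelHeight_rpow_eq_cm_two L hij hN hcδ hδ ν h𝓕 μE μf σ,
    ← inv_measure_mul_integral_finFactor_eq_eulerProduct L hij hN hcδ hδ νv hσ μf S hS, Complex.real_smul]
  push_cast
  ring

end Assembly

end Summit.HodgeConjecture.HodgeConjecture.Cruxes.H413.K2E1IntertwiningScalarEulerProductU2

end
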